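import Mathlib
import Literature.NumberTheory.LFunctions.Zhang2022.Section14Eq146Assembly
import Literature.NumberTheory.LFunctions.Zhang2022.Section14U017Generic
import Literature.NumberTheory.LFunctions.Zhang2022.Section14Prop141Twisted
import HarnessLib

/-!
# Zhang (2022) §14: (14.6) at general `β` from the two (14.8)-type legs at the modulus `D₂k`
# — the W-146 edge of the Proposition 14.1 chain, kernel-checked

Topic `Literature/NumberTheory/LFunctions/Zhang2022` (Landau–Siegel audit tree; verdict-neutral).
Y. Zhang, *Discrete mean estimates and the Landau–Siegel zero*, arXiv:2211.02515v1 (2022)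
[Zhang2022LandauSiegel] — **an unrefereed manuscript under adjudication**; nothing here asserts or
denies its Theorems 1–2 or Proposition 14.1. ZHANG-L discharge lane, helper under the leaf
`Skeleton.Prop141` (node `Z22:(14.6)`; rows G-adj2-4, G-L3t7-1). The manuscript's text for (14.6) is
one sentence (p. 79, tex L3966–L3969: "The proof of (14.6) is similar … the main terms … do not
appear"); the general-`β` case of Proposition 14.1 is "almost identical" (p. 76).

`eq146W_of_legs` — **(14.6)ᵂ ⇐ leg₁ ∧ leg₂**: the hypothesis `h146` of
`Section14Prop141Twisted.prop141_of_parts` (the weighted (14.6):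
`‖Σ_{p∼P} χ(p)(pt₀)^β 𝒮(D₁,D₂;p)‖ ≤ C·P²·D^{1/2−c}` for `‖β‖ < 5α`, `D = D₁D₂`, `D₁ > 1`) follows from
the two (14.8)-type estimates AT THE MODULUS `D₂k` ("for `1 < r < D³` … Lemma 5.6; for `D³ ≤ r` … the
large sieve", p. 79), stated inline as hypotheses in the shape of `rhs1417OnW` with `(D, κ*(d·))`
replaced by `(D₂, κ*(D₁d·))`: the reduction `norm_sum_window_calS_le` (weight `w = χ·(pt₀)^β`,
`|w| ≤ e^{15π}` by `norm_wt_le`), the conductor re-indexing `nonprincipal₂_le_reindex`, the principal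
characters `≪ d(D₁)⁴P²𝓛⁸⁴⁵ ≤ C·P²·D^{3/8}` (divisor bound, `𝓛⁸⁴⁵ ≤ D^{1/4}`), `c = min(c₁,c₂,1/8)`.
`eq146_of_legsW` — the `β = 0` instance gives the typed node `Typed.Sec14.Eq146` ((14.6) as printed).
No new definitions; no Assumption (A) is used beyond passing it to the legs.

## References

* Y. Zhang, arXiv:2211.02515v1 (2022), §14 pp. 76–79: Prop. 14.1, (14.6), (14.8), u017,
  tex L3849, L3915, L3945–L3969. [cite: Zhang2022LandauSiegel, §14 (14.6) p.78–79]
-/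

noncomputable section

open Complex Real ComplexConjugate

namespace Literature.NumberTheory.LFunctions.Zhang2022.Typed.Sec14

open Skeleton DirichletCharacter

/-! ## Small reshaping lemmas -/

/-- Reordering the `p`-summand: `(χ(p)(pt₀)^β)θ̄(p) = χ(p)θ̄(p)(pt₀)^β`. [folklore] -/
private theorem leg_reorder {D : ℕ} (χ : DirichletCharacter ℂ D) (β : ℂ) (κs : ℕ → ℂ)
    (D₁ D₂ : ℕ) (S : Finset ℕ) :
    ∑ d ∈ Finset.Icc 1 ⌊2 * P4 D⌋₊, (d : ℝ)⁻¹ *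
      ∑ r ∈ S,
        ∑ h ∈ (Finset.Ico 1 ⌈bigP D / r⌉₊).filter (fun h => D₂ / Nat.gcd D₂ r ∣ h),
          (D₂ : ℝ) / ((Nat.totient (h * r) : ℝ) * h * Real.sqrt r) *
            ∑ θ' ∈ finsetOf {θ' : DirichletCharacter ℂ r | θ'.IsPrimitive ∧
                changeLevel (dvd_mul_left r D) θ' ≠ changeLevel (dvd_mul_right D r) χ},
              ‖∑' l : ℕ, if Nat.Coprime l h then κs (D₁ * d * l) * θ' (l : ZMod r) *
                  ∑ p ∈ primeWindow D, (χ (p : ZMod D) * wt D β p) * θ'⁻¹ (p : ZMod r) *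
                  DeltaW D ((l : ℝ) / ((p : ℝ) * h * r)) else 0‖ =
    ∑ d ∈ Finset.Icc 1 ⌊2 * P4 D⌋₊, (d : ℝ)⁻¹ *
      ∑ r ∈ S,
        ∑ h ∈ (Finset.Ico 1 ⌈bigP D / r⌉₊).filter (fun h => D₂ / Nat.gcd D₂ r ∣ h),
          (D₂ : ℝ) / ((Nat.totient (h * r) : ℝ) * h * Real.sqrt r) *
            ∑ θ' ∈ finsetOf {θ' : DirichletCharacter ℂ r | θ'.IsPrimitive ∧
                changeLevel (dvd_mul_left r D) θ' ≠ changeLevel (dvd_mul_right D r) χ},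
              ‖∑' l : ℕ, if Nat.Coprime l h then κs (D₁ * d * l) * θ' (l : ZMod r) *
                  ∑ p ∈ primeWindow D, χ (p : ZMod D) * θ'⁻¹ (p : ZMod r) * wt D β p *
                  DeltaW D ((l : ℝ) / ((p : ℝ) * h * r)) else 0‖ := by
  refine Finset.sum_congr rfl fun d _ => ?_
  congr 1
  refine Finset.sum_congr rfl fun r _ => Finset.sum_congr rfl fun h _ => ?_
  congr 1
  refine Finset.sum_congr rfl fun θ' _ => ?_
  congr 1
  refine tsum_congr fun l => ?_
  split_ifs
  · congr 1
    refine Finset.sum_congr rfl fun p _ => ?_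
    ring
  · rfl

/-- Every term of the leg sum is non-negative. [folklore] -/
private theorem leg_nonneg {D : ℕ} (χ : DirichletCharacter ℂ D) (β : ℂ) (κs : ℕ → ℂ)
    (D₁ D₂ : ℕ) (S : Finset ℕ) :
    0 ≤
    ∑ d ∈ Finset.Icc 1 ⌊2 * P4 D⌋₊, (d : ℝ)⁻¹ *
      ∑ r ∈ S,
        ∑ h ∈ (Finset.Ico 1 ⌈bigP D / r⌉₊).filter (fun h => D₂ / Nat.gcd D₂ r ∣ h),
          (D₂ : ℝ) / ((Nat.totient (h * r) : ℝ) * h * Real.sqrt r) *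
            ∑ θ' ∈ finsetOf {θ' : DirichletCharacter ℂ r | θ'.IsPrimitive ∧
                changeLevel (dvd_mul_left r D) θ' ≠ changeLevel (dvd_mul_right D r) χ},
              ‖∑' l : ℕ, if Nat.Coprime l h then κs (D₁ * d * l) * θ' (l : ZMod r) *
                  ∑ p ∈ primeWindow D, χ (p : ZMod D) * θ'⁻¹ (p : ZMod r) * wt D β p *
                  DeltaW D ((l : ℝ) / ((p : ℝ) * h * r)) else 0‖ := by
  refine Finset.sum_nonneg fun d _ => mul_nonneg (inv_nonneg.mpr (Nat.cast_nonneg d)) ?_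
  refine Finset.sum_nonneg fun r _ => Finset.sum_nonneg fun h _ => mul_nonneg ?_ ?_
  · exact div_nonneg (Nat.cast_nonneg D₂)
      (mul_nonneg (mul_nonneg (Nat.cast_nonneg _) (Nat.cast_nonneg h)) (Real.sqrt_nonneg r))
  · exact Finset.sum_nonneg fun θ _ => norm_nonneg _

/-- The leg sum splits over the two `r`-ranges. [cite: Zhang2022LandauSiegel, §14 (14.8) (proof) p.79] -/
private theorem leg_split {D : ℕ} (χ : DirichletCharacter ℂ D) (β : ℂ) (κs : ℕ → ℂ) (D₁ D₂ : ℕ) :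
    ∑ d ∈ Finset.Icc 1 ⌊2 * P4 D⌋₊, (d : ℝ)⁻¹ *
      ∑ r ∈ Finset.Icc 2 ⌊2 * (D₂ : ℝ) * P4 D⌋₊,
        ∑ h ∈ (Finset.Ico 1 ⌈bigP D / r⌉₊).filter (fun h => D₂ / Nat.gcd D₂ r ∣ h),
          (D₂ : ℝ) / ((Nat.totient (h * r) : ℝ) * h * Real.sqrt r) *
            ∑ θ' ∈ finsetOf {θ' : DirichletCharacter ℂ r | θ'.IsPrimitive ∧
                changeLevel (dvd_mul_left r D) θ' ≠ changeLevel (dvd_mul_right D r) χ},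
              ‖∑' l : ℕ, if Nat.Coprime l h then κs (D₁ * d * l) * θ' (l : ZMod r) *
                  ∑ p ∈ primeWindow D, χ (p : ZMod D) * θ'⁻¹ (p : ZMod r) * wt D β p *
                  DeltaW D ((l : ℝ) / ((p : ℝ) * h * r)) else 0‖ =
    ∑ d ∈ Finset.Icc 1 ⌊2 * P4 D⌋₊, (d : ℝ)⁻¹ *
      ∑ r ∈ (Finset.Icc 2 ⌊2 * (D₂ : ℝ) * P4 D⌋₊).filter (fun r => r < D ^ 3),
        ∑ h ∈ (Finset.Ico 1 ⌈bigP D / r⌉₊).filter (fun h => D₂ / Nat.gcd D₂ r ∣ h),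
          (D₂ : ℝ) / ((Nat.totient (h * r) : ℝ) * h * Real.sqrt r) *
            ∑ θ' ∈ finsetOf {θ' : DirichletCharacter ℂ r | θ'.IsPrimitive ∧
                changeLevel (dvd_mul_left r D) θ' ≠ changeLevel (dvd_mul_right D r) χ},
              ‖∑' l : ℕ, if Nat.Coprime l h then κs (D₁ * d * l) * θ' (l : ZMod r) *
                  ∑ p ∈ primeWindow D, χ (p : ZMod D) * θ'⁻¹ (p : ZMod r) * wt D β p *
                  DeltaW D ((l : ℝ) / ((p : ℝ) * h * r)) else 0‖ +
    ∑ d ∈ Finset.Icc 1 ⌊2 * P4 D⌋₊, (d : ℝ)⁻¹ *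
      ∑ r ∈ (Finset.Icc 2 ⌊2 * (D₂ : ℝ) * P4 D⌋₊).filter (fun r => ¬ r < D ^ 3),
        ∑ h ∈ (Finset.Ico 1 ⌈bigP D / r⌉₊).filter (fun h => D₂ / Nat.gcd D₂ r ∣ h),
          (D₂ : ℝ) / ((Nat.totient (h * r) : ℝ) * h * Real.sqrt r) *
            ∑ θ' ∈ finsetOf {θ' : DirichletCharacter ℂ r | θ'.IsPrimitive ∧
                changeLevel (dvd_mul_left r D) θ' ≠ changeLevel (dvd_mul_right D r) χ},
              ‖∑' l : ℕ, if Nat.Coprime l h then κs (D₁ * d * l) * θ' (l : ZMod r) *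
                  ∑ p ∈ primeWindow D, χ (p : ZMod D) * θ'⁻¹ (p : ZMod r) * wt D β p *
                  DeltaW D ((l : ℝ) / ((p : ℝ) * h * r)) else 0‖ := by
  rw [← Finset.sum_add_distrib]
  refine Finset.sum_congr rfl fun d _ => ?_
  rw [← mul_add, Finset.sum_filter_add_sum_filter_not]

/-! ## (14.6) at general `β` from the two legs at the modulus `D₂k` -/

/-- **(14.6)ᵂ ⇐ leg₁ ∧ leg₂** — the weighted (14.6) in the exact shape of the hypothesis `h146` of
`prop141_of_parts`, from the two (14.8)-type leg estimates at the modulus `D₂k` ("`1 < r < D³`: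
Mellin transform, Lemma 5.4 (i), Lemma 5.6; `D³ ≤ r`: … the large sieve inequality", p. 79), each
stated inline (the `rhs1417OnW`-shape with `(D, κ*(d·)) ↦ (D₂, κ*(D₁d·))`). Route: (14.7)′ +
principal/non-principal split with the weight `w = χ·(pt₀)^β`, `|w| ≤ e^{15π}`
(`norm_sum_window_calS_le`, `norm_wt_le`); the non-principal part re-indexed by conductor
(`nonprincipal₂_le_reindex`) is `≤ B·(leg₁ + leg₂) ≤ B(|C₁|+|C₂|)P²D^{−min(c₁,c₂)}`; the principal part
`3e^{15π}C·d(D₁)⁴P²𝓛⁸⁴⁵ ≤ C'P²D^{3/8}` (`d(D₁) ≤ C_δD^{1/32}`, `𝓛⁸⁴⁵ ≤ D^{1/4}`); `c = min(c₁,c₂,1/8)`.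
[cite: Zhang2022LandauSiegel, §14 (14.6) pp.78–79, tex L3915, L3960–L3969; Prop. 14.1 p.76] -/
theorem eq146W_of_legs
    (hleg1 : ∀ B : ℝ, ∃ c : ℝ, 0 < c ∧ ∃ C : ℝ, ForAllLarge fun D _ χ => AssumptionA D χ →
      ∀ β : ℂ, ‖β‖ < 5 * alpha D → ∀ κs as : ℕ → ℂ, Eq141 B κs → Eq142 D B as →
        ∀ D₁ D₂ : ℕ, D₁ * D₂ = D → 1 < D₁ →
          ∑ d ∈ Finset.Icc 1 ⌊2 * P4 D⌋₊, (d : ℝ)⁻¹ *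
            ∑ r ∈ (Finset.Icc 2 ⌊2 * (D₂ : ℝ) * P4 D⌋₊).filter (fun r => r < D ^ 3),
              ∑ h ∈ (Finset.Ico 1 ⌈bigP D / r⌉₊).filter (fun h => D₂ / Nat.gcd D₂ r ∣ h),
                (D₂ : ℝ) / ((Nat.totient (h * r) : ℝ) * h * Real.sqrt r) *
                  ∑ θ' ∈ finsetOf {θ' : DirichletCharacter ℂ r | θ'.IsPrimitive ∧
                      changeLevel (dvd_mul_left r D) θ' ≠ changeLevel (dvd_mul_right D r) χ},
                    ‖∑' l : ℕ, if Nat.Coprime l h then κs (D₁ * d * l) * θ' (l : ZMod r) *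
                        ∑ p ∈ primeWindow D, χ (p : ZMod D) * θ'⁻¹ (p : ZMod r) * wt D β p *
                        DeltaW D ((l : ℝ) / ((p : ℝ) * h * r)) else 0‖
          ≤ C * bigP D ^ 2 * (D : ℝ) ^ (-c))
    (hleg2 : ∀ B : ℝ, ∃ c : ℝ, 0 < c ∧ ∃ C : ℝ, ForAllLarge fun D _ χ => AssumptionA D χ →
      ∀ β : ℂ, ‖β‖ < 5 * alpha D → ∀ κs as : ℕ → ℂ, Eq141 B κs → Eq142 D B as →
        ∀ D₁ D₂ : ℕ, D₁ * D₂ = D → 1 < D₁ →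
          ∑ d ∈ Finset.Icc 1 ⌊2 * P4 D⌋₊, (d : ℝ)⁻¹ *
            ∑ r ∈ (Finset.Icc 2 ⌊2 * (D₂ : ℝ) * P4 D⌋₊).filter (fun r => ¬ r < D ^ 3),
              ∑ h ∈ (Finset.Ico 1 ⌈bigP D / r⌉₊).filter (fun h => D₂ / Nat.gcd D₂ r ∣ h),
                (D₂ : ℝ) / ((Nat.totient (h * r) : ℝ) * h * Real.sqrt r) *
                  ∑ θ' ∈ finsetOf {θ' : DirichletCharacter ℂ r | θ'.IsPrimitive ∧
                      changeLevel (dvd_mul_left r D) θ' ≠ changeLevel (dvd_mul_right D r) χ},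
                    ‖∑' l : ℕ, if Nat.Coprime l h then κs (D₁ * d * l) * θ' (l : ZMod r) *
                        ∑ p ∈ primeWindow D, χ (p : ZMod D) * θ'⁻¹ (p : ZMod r) * wt D β p *
                        DeltaW D ((l : ℝ) / ((p : ℝ) * h * r)) else 0‖
          ≤ C * bigP D ^ 2 * (D : ℝ) ^ (-c))
    :
    ∀ B : ℝ, ∃ c : ℝ, 0 < c ∧ ∃ C : ℝ, ForAllLarge fun D _ χ => AssumptionA D χ →
      ∀ β : ℂ, ‖β‖ < 5 * alpha D → ∀ κs as : ℕ → ℂ, Eq141 B κs → Eq142 D B as →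
        ∀ D₁ D₂ : ℕ, D₁ * D₂ = D → 1 < D₁ →
          ‖∑ p ∈ primeWindow D, χ (p : ZMod D) * wt D β p * calS D D₁ D₂ p κs as‖
            ≤ C * bigP D ^ 2 * (D : ℝ) ^ (1 / 2 - c) := by
  intro B
  obtain ⟨c₁, hc₁, C₁, D₁', h1⟩ := hleg1 B
  obtain ⟨c₂, hc₂, C₂, D₂', h2⟩ := hleg2 B
  obtain ⟨Cp, hCp0, Dr, hred⟩ := norm_sum_window_calS_le B
  obtain ⟨Dn, hn⟩ := nonprincipal₂_le_reindex
  obtain ⟨Cd, hCd1, hCd⟩ :=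
    Literature.NumberTheory.Sieve.exists_card_divisors_le_mul_rpow (show (0 : ℝ) < 1 / 32 by norm_num)
  obtain ⟨Dl, hDl⟩ := eventually_log_rpow_le_rpow_quarter (845 : ℝ)
  obtain ⟨D₃, hD₃⟩ := exists_nat_forall_le_ell 3
  set W : ℝ := Real.exp (15 * π) with hW_def
  have hW0 : 0 ≤ W := (Real.exp_pos _).le
  set c : ℝ := min (min c₁ c₂) (1 / 8) with hc_def
  refine ⟨c, lt_min (lt_min hc₁ hc₂) (by norm_num), 3 * W * Cp * Cd ^ 4 + |B| * (|C₁| + |C₂|), ?_⟩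
  refine ⟨max (max (max D₁' D₂') (max Dr Dn)) (max (max Dl D₃) 3),
    fun D _ χ hD hq hprim hA β hβ κs as h141 h142 D₁ D₂ hD₁₂ hD₁ => ?_⟩
  have hDa : max (max D₁' D₂') (max Dr Dn) ≤ D := le_trans (le_max_left _ _) hD
  have hDb : max (max Dl D₃) 3 ≤ D := le_trans (le_max_right _ _) hD
  have hD1' : D₁' ≤ D := le_trans (le_trans (le_max_left _ _) (le_max_left _ _)) hDa
  have hD2' : D₂' ≤ D := le_trans (le_trans (le_max_right _ _) (le_max_left _ _)) hDa
  have hDr : Dr ≤ D := le_trans (le_trans (le_max_left _ _) (le_max_right _ _)) hDa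
  have hDn : Dn ≤ D := le_trans (le_trans (le_max_right _ _) (le_max_right _ _)) hDa
  have hDl' : Dl ≤ D := le_trans (le_trans (le_max_left _ _) (le_max_left _ _)) hDb
  have hD₃' : D₃ ≤ D := le_trans (le_trans (le_max_right _ _) (le_max_left _ _)) hDb
  have hD3 : 3 ≤ D := le_trans (le_max_right _ _) hDb
  have hℓ3 : 3 ≤ ell D := hD₃ D hD₃'
  have hD1 : (1 : ℝ) ≤ D := by exact_mod_cast (show 1 ≤ D by omega)
  have hD0 : (0 : ℝ) < D := by linarith
  have hP2 : 0 ≤ bigP D ^ 2 := sq_nonneg _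
  have hB0 : 0 ≤ B := (norm_nonneg _).trans (h142.1 0)
  -- the weight `w = χ·(pt₀)^β`
  have hw : ∀ p ∈ primeWindow D, ‖χ (p : ZMod D) * wt D β p‖ ≤ W := by
    intro p hp
    rw [norm_mul]
    calc ‖χ (p : ZMod D)‖ * ‖wt D β p‖ ≤ 1 * W :=
          mul_le_mul (DirichletCharacter.norm_le_one χ _) (norm_wt_le hℓ3 hp hβ.le) (norm_nonneg _)
            zero_le_one
      _ = W := one_mul _
  -- the reduction and the re-indexing
  have hR := hred D hDr inferInstance χ hq hprim κs as h141 h142 D₁ D₂ hD₁₂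
    (fun p => χ (p : ZMod D) * wt D β p) W hW0 hw
  have hN := hn D hDn inferInstance χ hprim as B h142.1 κs (fun p => χ (p : ZMod D) * wt D β p)
    D₁ D₂ hD₁₂ hD₁
  beta_reduce at hR hN
  rw [leg_reorder χ β κs D₁ D₂, leg_split χ β κs D₁ D₂] at hN
  -- the two legs
  have e1 := h1 D χ hD1' hq hprim hA β hβ κs as h141 h142 D₁ D₂ hD₁₂ hD₁
  have e2 := h2 D χ hD2' hq hprim hA β hβ κs as h141 h142 D₁ D₂ hD₁₂ hD₁
  -- sizes: `d(D₁)⁴ ≤ Cd⁴ D^{1/8}`, `𝓛⁸⁴⁵ ≤ D^{1/4}`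
  have hD₁0 : D₁ ≠ 0 := by omega
  have hD₁D : (D₁ : ℝ) ≤ D := by
    have hD₂1 : 1 ≤ D₂ := Nat.pos_of_ne_zero fun h => by subst h; omega
    have : D₁ ≤ D := by
      calc D₁ = D₁ * 1 := (mul_one _).symm
        _ ≤ D₁ * D₂ := Nat.mul_le_mul_left _ hD₂1
        _ = D := hD₁₂
    exact_mod_cast this
  have hdiv : (D₁.divisors.card : ℝ) ^ 4 ≤ Cd ^ 4 * (D : ℝ) ^ (1 / 8 : ℝ) := by
    have h := hCd D₁ hD₁0
    have hD₁0' : (0 : ℝ) ≤ D₁ := Nat.cast_nonneg _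
    have h' : (D₁.divisors.card : ℝ) ≤ Cd * (D : ℝ) ^ (1 / 32 : ℝ) :=
      h.trans (mul_le_mul_of_nonneg_left (Real.rpow_le_rpow hD₁0' hD₁D (by norm_num))
        (by linarith))
    calc (D₁.divisors.card : ℝ) ^ 4 ≤ (Cd * (D : ℝ) ^ (1 / 32 : ℝ)) ^ 4 :=
          pow_le_pow_left₀ (Nat.cast_nonneg _) h' 4
      _ = Cd ^ 4 * ((D : ℝ) ^ (1 / 32 : ℝ)) ^ 4 := mul_pow _ _ _
      _ = Cd ^ 4 * (D : ℝ) ^ (1 / 8 : ℝ) := by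
          rw [← Real.rpow_natCast ((D : ℝ) ^ (1 / 32 : ℝ)) 4, ← Real.rpow_mul hD0.le]
          norm_num
  have hlog : ell D ^ (845 : ℕ) ≤ (D : ℝ) ^ (1 / 4 : ℝ) := by
    have := hDl D hDl'
    rw [ell, ← Real.rpow_natCast]
    exact_mod_cast this
  -- exponents
  have hcc₁ : c ≤ c₁ := (min_le_left _ _).trans (min_le_left _ _)
  have hcc₂ : c ≤ c₂ := (min_le_left _ _).trans (min_le_right _ _)
  have hc8 : c ≤ 1 / 8 := min_le_right _ _
  have h38 : (D : ℝ) ^ (1 / 8 : ℝ) * (D : ℝ) ^ (1 / 4 : ℝ) ≤ (D : ℝ) ^ (1 / 2 - c) := by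
    rw [← Real.rpow_add hD0]
    exact Real.rpow_le_rpow_of_exponent_le hD1 (by linarith)
  have hpc₁ : (D : ℝ) ^ (-c₁) ≤ (D : ℝ) ^ (1 / 2 - c) :=
    Real.rpow_le_rpow_of_exponent_le hD1 (by linarith)
  have hpc₂ : (D : ℝ) ^ (-c₂) ≤ (D : ℝ) ^ (1 / 2 - c) :=
    Real.rpow_le_rpow_of_exponent_le hD1 (by linarith)
  -- the principal part
  have hprinc : 3 * W * Cp * (D₁.divisors.card : ℝ) ^ 4 * bigP D ^ 2 * ell D ^ (845 : ℕ) ≤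
      3 * W * Cp * Cd ^ 4 * bigP D ^ 2 * (D : ℝ) ^ (1 / 2 - c) := by
    have hℓ0 : 0 ≤ ell D ^ (845 : ℕ) := pow_nonneg (Real.log_natCast_nonneg D) _
    calc 3 * W * Cp * (D₁.divisors.card : ℝ) ^ 4 * bigP D ^ 2 * ell D ^ (845 : ℕ)
        = 3 * W * Cp * bigP D ^ 2 * ((D₁.divisors.card : ℝ) ^ 4 * ell D ^ (845 : ℕ)) := by ring
      _ ≤ 3 * W * Cp * bigP D ^ 2 * ((Cd ^ 4 * (D : ℝ) ^ (1 / 8 : ℝ)) * (D : ℝ) ^ (1 / 4 : ℝ)) := by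
          have h0 : 0 ≤ 3 * W * Cp * bigP D ^ 2 := by positivity
          exact mul_le_mul_of_nonneg_left (mul_le_mul hdiv hlog hℓ0 (by positivity)) h0
      _ = 3 * W * Cp * Cd ^ 4 * bigP D ^ 2 * ((D : ℝ) ^ (1 / 8 : ℝ) * (D : ℝ) ^ (1 / 4 : ℝ)) := by
          ring
      _ ≤ 3 * W * Cp * Cd ^ 4 * bigP D ^ 2 * (D : ℝ) ^ (1 / 2 - c) := by
          have h0 : 0 ≤ 3 * W * Cp * Cd ^ 4 * bigP D ^ 2 := by positivity
          exact mul_le_mul_of_nonneg_left h38 h0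
  -- the two legs combined
  have hL₁ := leg_nonneg χ β κs D₁ D₂ ((Finset.Icc 2 ⌊2 * (D₂ : ℝ) * P4 D⌋₊).filter (fun r => r < D ^ 3))
  have hL₂ := leg_nonneg χ β κs D₁ D₂ ((Finset.Icc 2 ⌊2 * (D₂ : ℝ) * P4 D⌋₊).filter (fun r => ¬ r < D ^ 3))
  have hlegs : B * (
      ∑ d ∈ Finset.Icc 1 ⌊2 * P4 D⌋₊, (d : ℝ)⁻¹ *
        ∑ r ∈ (Finset.Icc 2 ⌊2 * (D₂ : ℝ) * P4 D⌋₊).filter (fun r => r < D ^ 3),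
          ∑ h ∈ (Finset.Ico 1 ⌈bigP D / r⌉₊).filter (fun h => D₂ / Nat.gcd D₂ r ∣ h),
            (D₂ : ℝ) / ((Nat.totient (h * r) : ℝ) * h * Real.sqrt r) *
              ∑ θ' ∈ finsetOf {θ' : DirichletCharacter ℂ r | θ'.IsPrimitive ∧
                  changeLevel (dvd_mul_left r D) θ' ≠ changeLevel (dvd_mul_right D r) χ},
                ‖∑' l : ℕ, if Nat.Coprime l h then κs (D₁ * d * l) * θ' (l : ZMod r) *
                    ∑ p ∈ primeWindow D, χ (p : ZMod D) * θ'⁻¹ (p : ZMod r) * wt D β p *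
                    DeltaW D ((l : ℝ) / ((p : ℝ) * h * r)) else 0‖ +
      ∑ d ∈ Finset.Icc 1 ⌊2 * P4 D⌋₊, (d : ℝ)⁻¹ *
        ∑ r ∈ (Finset.Icc 2 ⌊2 * (D₂ : ℝ) * P4 D⌋₊).filter (fun r => ¬ r < D ^ 3),
          ∑ h ∈ (Finset.Ico 1 ⌈bigP D / r⌉₊).filter (fun h => D₂ / Nat.gcd D₂ r ∣ h),
            (D₂ : ℝ) / ((Nat.totient (h * r) : ℝ) * h * Real.sqrt r) *
              ∑ θ' ∈ finsetOf {θ' : DirichletCharacter ℂ r | θ'.IsPrimitive ∧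
                  changeLevel (dvd_mul_left r D) θ' ≠ changeLevel (dvd_mul_right D r) χ},
                ‖∑' l : ℕ, if Nat.Coprime l h then κs (D₁ * d * l) * θ' (l : ZMod r) *
                    ∑ p ∈ primeWindow D, χ (p : ZMod D) * θ'⁻¹ (p : ZMod r) * wt D β p *
                    DeltaW D ((l : ℝ) / ((p : ℝ) * h * r)) else 0‖) ≤
      |B| * (|C₁| + |C₂|) * bigP D ^ 2 * (D : ℝ) ^ (1 / 2 - c) := by
    have k1 : _ ≤ |C₁| * bigP D ^ 2 * (D : ℝ) ^ (1 / 2 - c) :=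
      calc _ ≤ C₁ * bigP D ^ 2 * (D : ℝ) ^ (-c₁) := e1
        _ ≤ |C₁| * bigP D ^ 2 * (D : ℝ) ^ (-c₁) := by gcongr; exact le_abs_self C₁
        _ ≤ |C₁| * bigP D ^ 2 * (D : ℝ) ^ (1 / 2 - c) := by gcongr
    have k2 : _ ≤ |C₂| * bigP D ^ 2 * (D : ℝ) ^ (1 / 2 - c) :=
      calc _ ≤ C₂ * bigP D ^ 2 * (D : ℝ) ^ (-c₂) := e2
        _ ≤ |C₂| * bigP D ^ 2 * (D : ℝ) ^ (-c₂) := by gcongr; exact le_abs_self C₂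
        _ ≤ |C₂| * bigP D ^ 2 * (D : ℝ) ^ (1 / 2 - c) := by gcongr
    calc B * (_ + _) ≤ |B| * (_ + _) := mul_le_mul_of_nonneg_right (le_abs_self B) (add_nonneg hL₁ hL₂)
      _ ≤ |B| * (|C₁| * bigP D ^ 2 * (D : ℝ) ^ (1 / 2 - c) + |C₂| * bigP D ^ 2 * (D : ℝ) ^ (1 / 2 - c)) :=
          mul_le_mul_of_nonneg_left (add_le_add k1 k2) (abs_nonneg B)
      _ = |B| * (|C₁| + |C₂|) * bigP D ^ 2 * (D : ℝ) ^ (1 / 2 - c) := by ring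
  calc ‖∑ p ∈ primeWindow D, χ (p : ZMod D) * wt D β p * calS D D₁ D₂ p κs as‖
      ≤ _ := hR
    _ ≤ 3 * W * Cp * Cd ^ 4 * bigP D ^ 2 * (D : ℝ) ^ (1 / 2 - c) +
          |B| * (|C₁| + |C₂|) * bigP D ^ 2 * (D : ℝ) ^ (1 / 2 - c) :=
        add_le_add hprinc (hN.trans hlegs)
    _ = (3 * W * Cp * Cd ^ 4 + |B| * (|C₁| + |C₂|)) * bigP D ^ 2 * (D : ℝ) ^ (1 / 2 - c) := by ring

/-- **(14.6) as printed (`Typed.Sec14.Eq146`) from the two legs** stated at general `β`: the `β = 0`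
instance of `eq146W_of_legs` (`(pt₀)^0 = 1`, `0 < 5α`). [cite: Zhang2022LandauSiegel, §14 (14.6) p.78] -/
theorem eq146_of_legsW
    (hleg1 : ∀ B : ℝ, ∃ c : ℝ, 0 < c ∧ ∃ C : ℝ, ForAllLarge fun D _ χ => AssumptionA D χ →
      ∀ β : ℂ, ‖β‖ < 5 * alpha D → ∀ κs as : ℕ → ℂ, Eq141 B κs → Eq142 D B as →
        ∀ D₁ D₂ : ℕ, D₁ * D₂ = D → 1 < D₁ →
          ∑ d ∈ Finset.Icc 1 ⌊2 * P4 D⌋₊, (d : ℝ)⁻¹ *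
            ∑ r ∈ (Finset.Icc 2 ⌊2 * (D₂ : ℝ) * P4 D⌋₊).filter (fun r => r < D ^ 3),
              ∑ h ∈ (Finset.Ico 1 ⌈bigP D / r⌉₊).filter (fun h => D₂ / Nat.gcd D₂ r ∣ h),
                (D₂ : ℝ) / ((Nat.totient (h * r) : ℝ) * h * Real.sqrt r) *
                  ∑ θ' ∈ finsetOf {θ' : DirichletCharacter ℂ r | θ'.IsPrimitive ∧
                      changeLevel (dvd_mul_left r D) θ' ≠ changeLevel (dvd_mul_right D r) χ},
                    ‖∑' l : ℕ, if Nat.Coprime l h then κs (D₁ * d * l) * θ' (l : ZMod r) *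
                        ∑ p ∈ primeWindow D, χ (p : ZMod D) * θ'⁻¹ (p : ZMod r) * wt D β p *
                        DeltaW D ((l : ℝ) / ((p : ℝ) * h * r)) else 0‖
          ≤ C * bigP D ^ 2 * (D : ℝ) ^ (-c))
    (hleg2 : ∀ B : ℝ, ∃ c : ℝ, 0 < c ∧ ∃ C : ℝ, ForAllLarge fun D _ χ => AssumptionA D χ →
      ∀ β : ℂ, ‖β‖ < 5 * alpha D → ∀ κs as : ℕ → ℂ, Eq141 B κs → Eq142 D B as →
        ∀ D₁ D₂ : ℕ, D₁ * D₂ = D → 1 < D₁ →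
          ∑ d ∈ Finset.Icc 1 ⌊2 * P4 D⌋₊, (d : ℝ)⁻¹ *
            ∑ r ∈ (Finset.Icc 2 ⌊2 * (D₂ : ℝ) * P4 D⌋₊).filter (fun r => ¬ r < D ^ 3),
              ∑ h ∈ (Finset.Ico 1 ⌈bigP D / r⌉₊).filter (fun h => D₂ / Nat.gcd D₂ r ∣ h),
                (D₂ : ℝ) / ((Nat.totient (h * r) : ℝ) * h * Real.sqrt r) *
                  ∑ θ' ∈ finsetOf {θ' : DirichletCharacter ℂ r | θ'.IsPrimitive ∧
                      changeLevel (dvd_mul_left r D) θ' ≠ changeLevel (dvd_mul_right D r) χ},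
                    ‖∑' l : ℕ, if Nat.Coprime l h then κs (D₁ * d * l) * θ' (l : ZMod r) *
                        ∑ p ∈ primeWindow D, χ (p : ZMod D) * θ'⁻¹ (p : ZMod r) * wt D β p *
                        DeltaW D ((l : ℝ) / ((p : ℝ) * h * r)) else 0‖
          ≤ C * bigP D ^ 2 * (D : ℝ) ^ (-c))
    : Eq146 := by
  intro B
  obtain ⟨c, hc, C, D₀, h⟩ := eq146W_of_legs hleg1 hleg2 B
  refine ⟨c, hc, C, max D₀ 3, fun D _ χ hD hq hprim hA κs as h141 h142 D₁ D₂ hD₁₂ hD₁ => ?_⟩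
  have hD0 : D₀ ≤ D := le_trans (le_max_left _ _) hD
  have hD3 : 3 ≤ D := le_trans (le_max_right _ _) hD
  have hα : ‖(0 : ℂ)‖ < 5 * alpha D := by
    rw [norm_zero]
    have hℓ : 0 < ell D := by
      have h3 : (3 : ℝ) ≤ D := by exact_mod_cast hD3
      exact Real.log_pos (by linarith)
    have : 0 < alpha D := by
      rw [alpha, bigP, Real.log_exp]; positivity
    linarith
  have key := h D χ hD0 hq hprim hA 0 hα κs as h141 h142 D₁ D₂ hD₁₂ hD₁
  simpa only [wt_zero, mul_one] using key

end Literature.NumberTheory.LFunctions.Zhang2022.Typed.Sec14
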